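import Literature.MathematicalPhysics.KineticTheory.KickMatchedHardSphereGas
import Literature.Analysis.FluidPDE.HardSphereTorusMeasure
import HarnessLib

/-!
# The exit / entry flux measures of a labelled pair of the kick-matched hard-sphere gas `Z*`
# and their disintegration along the impact vector

Topic `Literature/MathematicalPhysics/KineticTheory` (supports crux `stmt-AtomisticToContinuum-13914`,
`InformationPercolationEngine.PercolationClosesChaos`, line `stein-lindeberg-kick-swap`: node `exitFlux` and the
specular half of the heat-bath flux balance of the Gibbs-stationarity statement `KickMatchedStationaryCore` of `Z*`).
Grouping namespace `Literature.MathematicalPhysics.KineticTheory.KickMatchedHardSphereGas` (the vocabulary of `Z*`).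

For an ordered pair `(i, j)` of the `N + 1` labelled spheres of diameter `ε = hsDiameter σ N` on `𝕋³` the piece
`Σ_{ij} = {‖sepVec xᵢ xⱼ‖ = ε}` of the collision boundary is parametrised by `(z, ω) ↦ placeAt σ N i j (z, ω)` (the
partner `j` PLACED at contact with `i` along the unit normal `ω`, `xⱼ := xᵢ − ε ω`; everything else read from `z`).
In these coordinates the flux of a phase-space law `μ` through `Σ_{ij}` is `ε² ((w − v)·ω)₊ dσ(ω) μ(dz)`
(Cercignani–Illner–Pulvirenti 1994 App. 4.A p. 108, `dxⱼ = ε² |(vⱼ − vᵢ)·ω| dσ(ω) dt`). We DEFINE the flux measures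
`pairFlux σ N i j a b μ` (weight `((v_b − v_a)·ω)₊ = hardSphereKernel`, pushed forward by `placeAt`, restricted to the
hard-sphere domain), `exitFlux = pairFlux i j i j` (INCOMING weight `((vⱼ − vᵢ)·ω)₊`) and `entryFlux = pairFlux i j j i`
(OUTGOING weight), and PROVE
* `lintegral_pairFlux(_sphere)`: the disintegration `∫ F d(pairFlux) = ε² ∫ μ(dz) ∫_{placeAt (z,ω) ∈ D} F (placeAt (z, ω))
  fluxLaw_{v_a,v_b}(dω)` (Tonelli), and `lintegral_exitFlux`: for the exit flux the inner integral runs over the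
  ADMISSIBLE normals of the kick-matched rule (`IsAdmissible` differs from `placeAt (z, ω) ∈ D` only on the flux-null
  hemisphere `(w − v)·ω ≤ 0`) — conditional on `z`, the impact vector of the exit flux is drawn from `fluxLaw vᵢ vⱼ`
  restricted to the admissible set, the law the rejection sampler `kmNormal` reproduces;
* `exitFlux_preimage_collidePair` / `map_collidePair_exitFlux`: if `μ` is invariant under the reflection of the pair
  velocities across every normal (`collidePairWith`), the specular collision maps the exit flux to the entry flux;
* the `placeAt` API: `kickAt = collidePair ∘ placeAt` (`rfl`), `placeAt_placeAt`, `sepVec_placeAt` (the separation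
  vector of the placed pair is `ε ω`), `isAdmissible_placeAt_iff`, `collidePair_placeAt`, `measurable_placeAt`.

## References

* C. Cercignani, R. Illner, M. Pulvirenti, *The Mathematical Theory of Dilute Gases*, Springer (1994), App. 4.A
  p. 108 (the flux measure `ε^{d−1} |v·n| dσ dτ` of the hard-sphere boundary). [CIP1994]
* F. Comets, S. Popov, G. M. Schütz, M. Vachkovskaia, *Billiards in a general domain with random reflections*,
  ARMA 191 (2008), Thm 2.4 (flux-weighted boundary measures and the collision chain). [CometsEtAl2008]
-/

noncomputable section
noncomputable section

open scoped BigOperators ENNReal Topology RealInnerProductSpace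
open MeasureTheory Set Filter
open Literature.Analysis.FluidPDE

namespace Literature.MathematicalPhysics.KineticTheory.KickMatchedHardSphereGas

variable {σ : ℝ} {N : ℕ}

/-- The unit sphere of `ℝ³` (local notation). -/
local notation "𝕊²" => Metric.sphere (0 : V3) 1

/-! ## Placing the partner at contact -/

/-- **Place the partner `j` at contact with `i` along the normal `ω`**: `xⱼ := xᵢ − ε ω`, velocities and all
other particles untouched — the position part of `kickAt` (`kickAt σ N i j ω y = collidePair geo i j (placeAt σ N i j
(y, ω))` definitionally), i.e. the parametrisation of the boundary piece `Σ_{ij}` by (the other coordinates, the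
impact vector). [cite: CIP1994, App. 4.A p. 108] -/
def placeAt (σ : ℝ) (N : ℕ) (i j : Fin (N + 1)) (q : Cfg N × V3) : Cfg N :=
  Function.update q.1 j (geo.translate (q.1 i).1 (-(hsDiameter σ N • q.2)), (q.1 j).2)

/-- `kickAt` is `collidePair` after `placeAt` (definitional). [folklore] -/
theorem kickAt_eq_collidePair_placeAt (i j : Fin (N + 1)) (ω : V3) (y : Cfg N) :
    kickAt σ N i j ω y = collidePair geo i j (placeAt σ N i j (y, ω)) := rfl

/-- `placeAt` only moves the partner `j`. [folklore] -/
theorem placeAt_apply_of_ne {i j k : Fin (N + 1)} (hkj : k ≠ j) (q : Cfg N × V3) : placeAt σ N i j q k = q.1 k :=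
  Function.update_of_ne hkj _ _

/-- The partner `j` after `placeAt`: at `xᵢ − ε ω`, with its old velocity. [folklore] -/
theorem placeAt_apply_right (i j : Fin (N + 1)) (q : Cfg N × V3) :
    placeAt σ N i j q j = (geo.translate (q.1 i).1 (-(hsDiameter σ N • q.2)), (q.1 j).2) :=
  Function.update_self _ _ _

/-- `placeAt` does not change any velocity. [folklore] -/
@[simp]
theorem placeAt_apply_snd (i j : Fin (N + 1)) (q : Cfg N × V3) (k : Fin (N + 1)) :
    (placeAt σ N i j q k).2 = (q.1 k).2 := by
  by_cases hkj : k = j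
  · subst hkj; rw [placeAt_apply_right]
  · rw [placeAt_apply_of_ne hkj]

/-- Placing twice is placing once (the `j`-th position is overwritten; `i ≠ j`). [folklore] -/
theorem placeAt_placeAt {i j : Fin (N + 1)} (hij : i ≠ j) (z : Cfg N) (ω ω' : V3) :
    placeAt σ N i j (placeAt σ N i j (z, ω'), ω) = placeAt σ N i j (z, ω) := by
  unfold placeAt
  dsimp only
  rw [Function.update_of_ne hij, Function.update_self, Function.update_idem]

/-- **The separation vector of the placed pair is `ε ω`** (minimal image on the torus, `‖ε ω‖ < 1/2`, `i ≠ j`).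
[folklore] -/
theorem sepVec_placeAt {i j : Fin (N + 1)} (hij : i ≠ j) {ω : V3} (hω : ‖hsDiameter σ N • ω‖ < 1 / 2) (z : Cfg N) :
    geo.sepVec (placeAt σ N i j (z, ω) i).1 (placeAt σ N i j (z, ω) j).1 = hsDiameter σ N • ω := by
  rw [placeAt_apply_of_ne hij, placeAt_apply_right]
  dsimp only
  have h0 : geo.sepVec (z i).1 (z i).1 = 0 := by rw [Torus.geometry_sepVec, sub_self, Torus.reprSym_zero]
  have key := Torus.sepVec_translate_of_norm_lt (d := Fin 3) (x := (z i).1) (y := (z i).1) (a := 0)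
    (b := -(hsDiameter σ N • ω)) (by rwa [h0, norm_zero, zero_add, zero_sub, neg_neg])
  rwa [Geometry.translate_zero, h0, zero_add, zero_sub, neg_neg] at key

/-- **The admissible set seen from a placed configuration does not depend on where the partner was placed**:
for `y = placeAt (z, ω')`, `ω` is admissible iff it is a unit vector of the incoming hemisphere and `placeAt (z, ω)`
lies in the hard-sphere domain (`kickAt = collidePair ∘ placeAt`, collisions do not move particles). [folklore] -/
theorem isAdmissible_placeAt_iff {i j : Fin (N + 1)} (hij : i ≠ j) (z : Cfg N) (ω ω' : V3) :
    IsAdmissible σ N i j ω (placeAt σ N i j (z, ω')) ↔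
      ‖ω‖ = 1 ∧ 0 < ⟪(z j).2 - (z i).2, ω⟫ ∧ placeAt σ N i j (z, ω) ∈ hardSphereDomain geo (N + 1) (hsDiameter σ N) := by
  unfold IsAdmissible
  rw [kickAt_eq_collidePair_placeAt, placeAt_placeAt hij, collidePair_mem_hardSphereDomain_iff, placeAt_apply_snd,
    placeAt_apply_snd]

/-- `placeAt` is jointly measurable in (configuration, normal). [folklore] -/
theorem measurable_placeAt (i j : Fin (N + 1)) : Measurable (placeAt σ N i j) := by
  have hG : geo.IsMeasurable := Torus.isMeasurable_geometry
  have hpos : Measurable fun p : Cfg N × V3 => geo.translate (p.1 i).1 (-(hsDiameter σ N • p.2)) :=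
    hG.measurable_translate.comp (((Geometry.IsMeasurable.measurable_pos i).comp measurable_fst).prodMk
      (measurable_snd.const_smul (hsDiameter σ N)).neg)
  exact measurable_update'.comp (measurable_fst.prodMk
    (hpos.prodMk ((Geometry.IsMeasurable.measurable_vel j).comp measurable_fst)))

/-- The set of normals placing the pair inside the hard-sphere domain is measurable (on the unit sphere). [folklore] -/
theorem measurableSet_placeAt_mem (i j : Fin (N + 1)) (z : Cfg N) : MeasurableSet {ω : 𝕊² |
      placeAt σ N i j (z, (ω : V3)) ∈ hardSphereDomain geo (N + 1) (hsDiameter σ N)} :=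
  (measurableSet_hardSphereDomain geo Torus.measurable_geometry_sepVec (N + 1) (hsDiameter σ N)).preimage
    ((measurable_placeAt i j).comp (measurable_const.prodMk measurable_subtype_coe))

/-! ## The flux measures of the pair `(i, j)` -/

/-- **The flux measure of the pair `(i, j)` with weight `((v_b − v_a)·ω)₊`** over the phase-space law `μ`: the
measure `ε² ((v_b − v_a)·ω)₊ σ(dω) μ(dz)` on (configuration, unit normal), pushed forward by `placeAt σ N i j` and
restricted to the hard-sphere domain (CIP 1994 App. 4.A: in the coordinates `xⱼ = xᵢ − ε ω` of the boundary piece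
`Σ_{ij}`, `dxⱼ = ε² |(vⱼ − vᵢ)·ω| dσ(ω) dt`). `(a, b) = (i, j)` is the exit (incoming) flux, `(a, b) = (j, i)` the
entry (outgoing) flux. [cite: CIP1994, App. 4.A p. 108] -/
def pairFlux (σ : ℝ) (N : ℕ) (i j a b : Fin (N + 1)) (μ : Measure (Cfg N)) : Measure (Cfg N) :=
  ENNReal.ofReal (hsDiameter σ N ^ 2) • ((((μ.prod sphereMeasure).withDensity fun q : Cfg N × 𝕊² =>
        ENNReal.ofReal (hardSphereKernel ((q.1 b).2, (q.1 a).2) q.2)).map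
      fun q : Cfg N × 𝕊² => placeAt σ N i j (q.1, (q.2 : V3))).restrict
      (hardSphereDomain geo (N + 1) (hsDiameter σ N)))

/-- **The exit flux of the pair `(i, j)`** over `μ`: INCOMING placed configurations (`(vⱼ − vᵢ)·ω > 0`, about to
collide), weighted by the normal speed `ε² ((vⱼ − vᵢ)·ω)₊`. [cite: CIP1994, App. 4.A p. 108] -/
abbrev exitFlux (σ : ℝ) (N : ℕ) (i j : Fin (N + 1)) (μ : Measure (Cfg N)) : Measure (Cfg N) :=
  pairFlux σ N i j i j μ

/-- **The entry flux of the pair `(i, j)`** over `μ`: OUTGOING placed configurations, weight `ε² ((vᵢ − vⱼ)·ω)₊`.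
[cite: CIP1994, App. 4.A p. 108] -/
abbrev entryFlux (σ : ℝ) (N : ℕ) (i j : Fin (N + 1)) (μ : Measure (Cfg N)) : Measure (Cfg N) :=
  pairFlux σ N i j j i μ

/-- The flux weight `((v_b − v_a)·ω)₊` is jointly measurable. [folklore] -/
theorem measurable_fluxWeight (a b : Fin (N + 1)) : Measurable fun q : Cfg N × 𝕊² =>
      ENNReal.ofReal (hardSphereKernel ((q.1 b).2, (q.1 a).2) q.2) := by
  unfold hardSphereKernel
  refine Measurable.ennreal_ofReal (Measurable.max ?_ measurable_const)
  exact (((Geometry.IsMeasurable.measurable_vel (N := N + 1) (d := Fin 3) (X := T3) b).sub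
    (Geometry.IsMeasurable.measurable_vel a)).comp measurable_fst).inner
    (measurable_subtype_coe.comp measurable_snd)

/-- **The pair flux in the coordinates `(z, ω)`** (push-forward, restriction and density unfolded, Tonelli): for
measurable `F ≥ 0`, `∫ F d(pairFlux) = ε² ∫ μ(dz) ∫ σ(dω) ((v_b − v_a)·ω)₊ (1_D F)(placeAt (z, ω))`.
[cite: CIP1994, App. 4.A p. 108] -/
theorem lintegral_pairFlux_sphere (i j a b : Fin (N + 1)) (μ : Measure (Cfg N)) [SFinite μ] {F : Cfg N → ℝ≥0∞}
    (hF : Measurable F) :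
    ∫⁻ y, F y ∂(pairFlux σ N i j a b μ) = ENNReal.ofReal (hsDiameter σ N ^ 2) *
        ∫⁻ z, ∫⁻ ω : 𝕊², ENNReal.ofReal (hardSphereKernel ((z b).2, (z a).2) ω) *
          (hardSphereDomain geo (N + 1) (hsDiameter σ N)).indicator F (placeAt σ N i j (z, (ω : V3))) ∂sphereMeasure ∂μ := by
  haveI : IsFiniteMeasure (sphereMeasure : Measure (𝕊²)) := by unfold sphereMeasure; infer_instance
  have hD : MeasurableSet (hardSphereDomain geo (N + 1) (hsDiameter σ N)) :=
    measurableSet_hardSphereDomain geo Torus.measurable_geometry_sepVec (N + 1) (hsDiameter σ N)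
  have hP : Measurable fun q : Cfg N × 𝕊² => placeAt σ N i j (q.1, (q.2 : V3)) :=
    (measurable_placeAt i j).comp (measurable_fst.prodMk (measurable_subtype_coe.comp measurable_snd))
  have hρ := measurable_fluxWeight (N := N) a b
  have hFD : Measurable ((hardSphereDomain geo (N + 1) (hsDiameter σ N)).indicator F) := hF.indicator hD
  have e1 : ∫⁻ q, (hardSphereDomain geo (N + 1) (hsDiameter σ N)).indicator F (placeAt σ N i j (q.1, (q.2 : V3)))
      ∂((μ.prod sphereMeasure).withDensity fun q : Cfg N × 𝕊² =>
        ENNReal.ofReal (hardSphereKernel ((q.1 b).2, (q.1 a).2) q.2)) = _ :=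
    lintegral_withDensity_eq_lintegral_mul _ hρ (hFD.comp hP)
  have hae : AEMeasurable (fun q : Cfg N × 𝕊² => ENNReal.ofReal (hardSphereKernel ((q.1 b).2, (q.1 a).2) q.2) *
        (hardSphereDomain geo (N + 1) (hsDiameter σ N)).indicator F (placeAt σ N i j (q.1, (q.2 : V3))))
      (μ.prod sphereMeasure) := (hρ.mul (hFD.comp hP)).aemeasurable
  have e2 := lintegral_prod _ hae
  unfold pairFlux
  rw [lintegral_smul_measure, ← lintegral_indicator hD, lintegral_map hFD hP, e1, smul_eq_mul]
  exact congrArg _ e2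

/-- **Disintegration of the pair flux along the normal** (Fubini in the coordinates `(z, ω)`): for measurable
`F ≥ 0`, `∫ F d(pairFlux σ N i j a b μ) = ε² ∫ μ(dz) ∫_{ω : placeAt (z, ω) ∈ D} F (placeAt (z, ω)) fluxLaw_{v_a, v_b}(dω)`
— conditional on `z`, the impact vector is distributed by the flux law `fluxLaw (z a).2 (z b).2` restricted to the
normals placing the pair in the domain. [cite: CIP1994, App. 4.A p. 108] -/
theorem lintegral_pairFlux (i j a b : Fin (N + 1)) (μ : Measure (Cfg N)) [SFinite μ] {F : Cfg N → ℝ≥0∞}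
    (hF : Measurable F) :
    ∫⁻ y, F y ∂(pairFlux σ N i j a b μ) = ENNReal.ofReal (hsDiameter σ N ^ 2) * ∫⁻ z, ∫⁻ ω in {ω : 𝕊² |
            placeAt σ N i j (z, (ω : V3)) ∈ hardSphereDomain geo (N + 1) (hsDiameter σ N)},
          F (placeAt σ N i j (z, (ω : V3))) ∂(fluxLaw (z a).2 (z b).2) ∂μ := by
  rw [lintegral_pairFlux_sphere i j a b μ hF]
  refine congrArg (fun t => ENNReal.ofReal (hsDiameter σ N ^ 2) * t) (lintegral_congr fun z => ?_)
  have hPz : Measurable fun ω : 𝕊² => placeAt σ N i j (z, (ω : V3)) :=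
    (measurable_placeAt i j).comp (measurable_const.prodMk measurable_subtype_coe)
  have hρz : Measurable fun ω : 𝕊² => ENNReal.ofReal (hardSphereKernel ((z b).2, (z a).2) ω) := by
    unfold hardSphereKernel
    exact ((measurable_const.inner measurable_subtype_coe).max measurable_const).ennreal_ofReal
  have hSm := measurableSet_placeAt_mem (σ := σ) i j z
  have e2 : ∫⁻ ω, {ω : 𝕊² | placeAt σ N i j (z, (ω : V3)) ∈ hardSphereDomain geo (N + 1) (hsDiameter σ N)}.indicator
        (fun ω => F (placeAt σ N i j (z, (ω : V3)))) ω ∂(fluxLaw (z a).2 (z b).2) = _ :=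
    lintegral_withDensity_eq_lintegral_mul _ hρz ((hF.comp hPz).indicator hSm)
  rw [← lintegral_indicator hSm, e2]
  refine lintegral_congr fun ω => ?_
  rw [Pi.mul_apply]
  refine congrArg (fun t => ENNReal.ofReal (hardSphereKernel ((z b).2, (z a).2) ω) * t) ?_
  by_cases h : placeAt σ N i j (z, (ω : V3)) ∈ hardSphereDomain geo (N + 1) (hsDiameter σ N)
  · rw [indicator_of_mem h, indicator_of_mem (show ω ∈ {ω : 𝕊² |
      placeAt σ N i j (z, (ω : V3)) ∈ hardSphereDomain geo (N + 1) (hsDiameter σ N)} from h)]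
  · rw [indicator_of_notMem h, indicator_of_notMem (show ω ∉ {ω : 𝕊² |
      placeAt σ N i j (z, (ω : V3)) ∈ hardSphereDomain geo (N + 1) (hsDiameter σ N)} from h)]

/-! ## The exit flux lives on the admissible normals -/

/-- The flux law does not charge the closed hemisphere `(w − v)·ω ≤ 0` (its density `((w − v)·ω)₊` vanishes there).
[folklore] -/
theorem fluxLaw_inner_nonpos (v w : V3) : fluxLaw v w {ω : 𝕊² | ⟪w - v, (ω : V3)⟫ ≤ 0} = 0 := by
  have hm : MeasurableSet {ω : 𝕊² | ⟪w - v, (ω : V3)⟫ ≤ 0} :=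
    measurableSet_le (measurable_const.inner measurable_subtype_coe) measurable_const
  have h0 : ∀ ω ∈ {ω : 𝕊² | ⟪w - v, (ω : V3)⟫ ≤ 0}, ENNReal.ofReal (hardSphereKernel (w, v) ω) = 0 := fun ω hω => by
    unfold hardSphereKernel
    rw [max_eq_right (show ⟪w - v, (ω : V3)⟫ ≤ 0 from hω), ENNReal.ofReal_zero]
  unfold fluxLaw
  rw [withDensity_apply _ hm, setLIntegral_congr_fun hm h0, lintegral_zero]

/-- **Disintegration of the exit flux over the ADMISSIBLE normals**: for `i ≠ j` and measurable `F ≥ 0`,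
`∫ F d(exitFlux σ N i j μ) = ε² ∫ μ(dz) ∫_{A(z)} F (placeAt (z, ω)) fluxLaw_{vᵢ, vⱼ}(dω)` with
`A(z) = {ω | IsAdmissible σ N i j ω (placeAt (z, ω))}` the admissible set of the kick-matched rule (which, seen from
`placeAt (z, ω')`, does not depend on `ω'`, `isAdmissible_placeAt_iff`): conditional on everything but the impact
vector, the exit flux draws the impact vector from the flux law restricted to the admissible set — the law the
rejection sampler `kmNormal` reproduces. [cite: CIP1994, App. 4.A p. 108] -/
theorem lintegral_exitFlux {i j : Fin (N + 1)} (hij : i ≠ j) (μ : Measure (Cfg N)) [SFinite μ] {F : Cfg N → ℝ≥0∞}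
    (hF : Measurable F) :
    ∫⁻ y, F y ∂(exitFlux σ N i j μ) = ENNReal.ofReal (hsDiameter σ N ^ 2) *
        ∫⁻ z, ∫⁻ ω in {ω : 𝕊² | IsAdmissible σ N i j (ω : V3) (placeAt σ N i j (z, (ω : V3)))},
          F (placeAt σ N i j (z, (ω : V3))) ∂(fluxLaw (z i).2 (z j).2) ∂μ := by
  rw [exitFlux, lintegral_pairFlux i j i j μ hF]
  refine congrArg (fun t => ENNReal.ofReal (hsDiameter σ N ^ 2) * t) (lintegral_congr fun z => ?_)
  -- the two sets of normals differ only inside the flux-null hemisphere `(w − v)·ω ≤ 0`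
  have h : {ω : 𝕊² |
        placeAt σ N i j (z, (ω : V3)) ∈ hardSphereDomain geo (N + 1) (hsDiameter σ N)} =ᵐ[fluxLaw (z i).2 (z j).2]
      {ω : 𝕊² | IsAdmissible σ N i j (ω : V3) (placeAt σ N i j (z, (ω : V3)))} := by
    refine measure_symmDiff_eq_zero_iff.1 (measure_mono_null (fun ω hω => ?_) (fluxLaw_inner_nonpos (z i).2 (z j).2))
    simp only [mem_symmDiff, mem_setOf_eq, isAdmissible_placeAt_iff hij, norm_eq_of_mem_sphere ω, true_and] at hω
    show ⟪(z j).2 - (z i).2, (ω : V3)⟫ ≤ 0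
    rcases hω with ⟨h1, h2⟩ | ⟨h1, h2⟩
    · exact le_of_not_gt fun h' => h2 ⟨h', h1⟩
    · exact absurd h1.2 h2
  rw [Measure.restrict_congr_set h]

/-! ## The specular reflection maps the exit flux to the entry flux -/

/-- The controlled collision across a fixed normal is an involution (`reflectVel_reflectVel`). [folklore] -/
theorem collidePairWith_collidePairWith {i j : Fin (N + 1)} (hij : i ≠ j) (n : V3) (z : Cfg N) :
    collidePairWith i j n (collidePairWith i j n z) = z := by
  have hp : reflectVel n ((collidePairWith i j n z i).2, (collidePairWith i j n z j).2) = ((z i).2, (z j).2) := by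
    rw [collidePairWith_apply_left hij, collidePairWith_apply_right]
    exact reflectVel_reflectVel n ((z i).2, (z j).2)
  funext k
  by_cases hkj : k = j
  · subst hkj; rw [collidePairWith_apply_right, hp, collidePairWith_apply_fst]
  by_cases hki : k = i
  · subst hki; rw [collidePairWith_apply_left hkj, hp, collidePairWith_apply_fst]
  rw [collidePairWith_apply_of_ne hki hkj, collidePairWith_apply_of_ne hki hkj]

/-- The controlled collision across a fixed normal is measurable in the configuration. [folklore] -/
theorem measurable_collidePairWith (i j : Fin (N + 1)) (n : V3) :
    Measurable (collidePairWith i j n : Cfg N → Cfg N) := by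
  have hv : Measurable fun z : Cfg N => ((z i).2, (z j).2) :=
    (Geometry.IsMeasurable.measurable_vel i).prodMk (Geometry.IsMeasurable.measurable_vel j)
  have hr : Measurable (reflectVel n : V3 × V3 → V3 × V3) := by unfold reflectVel; fun_prop
  have h1 : Measurable fun z : Cfg N => ((z i).1, (reflectVel n ((z i).2, (z j).2)).1) :=
    (Geometry.IsMeasurable.measurable_pos i).prodMk (measurable_fst.comp (hr.comp hv))
  have h2 : Measurable fun z : Cfg N => ((z j).1, (reflectVel n ((z i).2, (z j).2)).2) :=
    (Geometry.IsMeasurable.measurable_pos j).prodMk (measurable_snd.comp (hr.comp hv))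
  unfold collidePairWith
  exact measurable_update'.comp ((measurable_update'.comp (measurable_id.prodMk h1)).prodMk h2)

/-- **Colliding a placed pair = placing the pair collided across `ω`**: the separation vector of
`placeAt (z, ω)` is `ε ω` (`sepVec_placeAt`) and only the line `ℝ ω` matters for the reflection. [folklore] -/
theorem collidePair_placeAt {i j : Fin (N + 1)} (hij : i ≠ j) (hε : hsDiameter σ N ≠ 0) {ω : V3}
    (hω : ‖hsDiameter σ N • ω‖ < 1 / 2) (z : Cfg N) :
    collidePair geo i j (placeAt σ N i j (z, ω)) = placeAt σ N i j (collidePairWith i j ω z, ω) := by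
  rw [← collidePairWith_sepVec, sepVec_placeAt hij hω, collidePairWith_smul hε]
  have hv : ((placeAt σ N i j (z, ω) i).2, (placeAt σ N i j (z, ω) j).2) = ((z i).2, (z j).2) := by
    rw [placeAt_apply_snd, placeAt_apply_snd]
  funext k
  by_cases hkj : k = j
  · subst hkj; rw [collidePairWith_apply_right, hv, placeAt_apply_right, placeAt_apply_right]; dsimp only
    rw [collidePairWith_apply_fst, collidePairWith_apply_right]
  by_cases hki : k = i
  · subst hki; rw [collidePairWith_apply_left hkj, hv, placeAt_apply_of_ne hkj, placeAt_apply_of_ne hkj]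
    dsimp only
    rw [collidePairWith_apply_left hkj]
  rw [collidePairWith_apply_of_ne hki hkj, placeAt_apply_of_ne hkj, placeAt_apply_of_ne hkj]
  dsimp only
  rw [collidePairWith_apply_of_ne hki hkj]

/-- **The specular reflection maps the exit flux to the entry flux.** If the phase-space law `μ` is invariant under
the controlled collision of the pair `(i, j)` across every normal (Lebesgue ⊗ product Maxwellian:
`map_reflectVel_maxwellianPair`), then for `i ≠ j`, `0 < ε < 1/2` and measurable `B`,
`exitFlux (collidePair⁻¹ B) = entryFlux B`: `collidePair ∘ placeAt (·, ω) = placeAt (·, ω) ∘ collidePairWith ω`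
(`collidePair_placeAt`), the reflection turns the incoming weight `((vⱼ − vᵢ)·ω)₊` into the outgoing one
(`inner_reflectVel_fst_sub_snd`) and preserves `μ` (Tonelli in `(z, ω)`). [cite: CometsEtAl2008, Thm 2.4] -/
theorem exitFlux_preimage_collidePair {i j : Fin (N + 1)} (hij : i ≠ j) (hε : 0 < hsDiameter σ N)
    (hε2 : hsDiameter σ N < 1 / 2) (μ : Measure (Cfg N)) [SFinite μ]
    (hμ : ∀ ω : V3, MeasurePreserving (collidePairWith i j ω : Cfg N → Cfg N) μ μ) {B : Set (Cfg N)}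
    (hB : MeasurableSet B) :
    exitFlux σ N i j μ (collidePair geo i j ⁻¹' B) = entryFlux σ N i j μ B := by
  haveI : IsFiniteMeasure (sphereMeasure : Measure (𝕊²)) := by unfold sphereMeasure; infer_instance
  have hcP : Measurable (collidePair geo i j : Cfg N → Cfg N) := Torus.isMeasurable_geometry.measurable_collidePair i j
  have hD : MeasurableSet (hardSphereDomain geo (N + 1) (hsDiameter σ N)) :=
    measurableSet_hardSphereDomain geo Torus.measurable_geometry_sepVec (N + 1) (hsDiameter σ N)
  have hP : Measurable fun q : Cfg N × 𝕊² => placeAt σ N i j (q.1, (q.2 : V3)) :=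
    (measurable_placeAt i j).comp (measurable_fst.prodMk (measurable_subtype_coe.comp measurable_snd))
  set Gx : Cfg N × 𝕊² → ℝ≥0∞ := fun q => ENNReal.ofReal (hardSphereKernel ((q.1 j).2, (q.1 i).2) q.2) *
      (hardSphereDomain geo (N + 1) (hsDiameter σ N)).indicator ((collidePair geo i j ⁻¹' B).indicator 1)
        (placeAt σ N i j (q.1, (q.2 : V3))) with hGx
  set Ge : Cfg N × 𝕊² → ℝ≥0∞ := fun q => ENNReal.ofReal (hardSphereKernel ((q.1 i).2, (q.1 j).2) q.2) *
      (hardSphereDomain geo (N + 1) (hsDiameter σ N)).indicator (B.indicator 1)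
        (placeAt σ N i j (q.1, (q.2 : V3))) with hGe
  have hGxm : Measurable Gx := (measurable_fluxWeight (N := N) i j).mul
    (((measurable_one.indicator (hB.preimage hcP)).indicator hD).comp hP)
  have hGem : Measurable Ge := (measurable_fluxWeight (N := N) j i).mul
    (((measurable_one.indicator hB).indicator hD).comp hP)
  have key : ∀ (ω : 𝕊²) (z : Cfg N), Gx (collidePairWith i j (ω : V3) z, ω) = Ge (z, ω) := by
    intro ω z
    have hω0 : (ω : V3) ≠ 0 := ne_zero_of_mem_unit_sphere ω
    have hωε : ‖hsDiameter σ N • (ω : V3)‖ < 1 / 2 := by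
      rw [norm_smul, Real.norm_eq_abs, abs_of_pos hε, norm_eq_of_mem_sphere, mul_one]; exact hε2
    have hvel : ⟪(collidePairWith i j (ω : V3) z j).2 - (collidePairWith i j (ω : V3) z i).2, (ω : V3)⟫ =
        ⟪(z i).2 - (z j).2, (ω : V3)⟫ := by
      have h := inner_reflectVel_fst_sub_snd (ω : V3) hω0 ((z i).2, (z j).2)
      dsimp only at h
      rw [collidePairWith_apply_left hij, collidePairWith_apply_right]
      dsimp only
      calc ⟪(reflectVel (ω : V3) ((z i).2, (z j).2)).2 - (reflectVel (ω : V3) ((z i).2, (z j).2)).1, (ω : V3)⟫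
          = ⟪(ω : V3), (reflectVel (ω : V3) ((z i).2, (z j).2)).2 - (reflectVel (ω : V3) ((z i).2, (z j).2)).1⟫ :=
            real_inner_comm _ _
        _ = -⟪(ω : V3), (reflectVel (ω : V3) ((z i).2, (z j).2)).1 - (reflectVel (ω : V3) ((z i).2, (z j).2)).2⟫ := by
            rw [← inner_neg_right, neg_sub]
        _ = ⟪(ω : V3), (z i).2 - (z j).2⟫ := by rw [h, neg_neg]
        _ = ⟪(z i).2 - (z j).2, (ω : V3)⟫ := real_inner_comm _ _
    have hpl : placeAt σ N i j (collidePairWith i j (ω : V3) z, (ω : V3)) =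
        collidePair geo i j (placeAt σ N i j (z, ω)) := (collidePair_placeAt hij hε.ne' hωε z).symm
    have hk : hardSphereKernel ((collidePairWith i j (ω : V3) z j).2, (collidePairWith i j (ω : V3) z i).2) ω =
        hardSphereKernel ((z i).2, (z j).2) ω := by
      unfold hardSphereKernel
      dsimp only
      rw [hvel]
    show ENNReal.ofReal (hardSphereKernel ((collidePairWith i j (ω : V3) z j).2, (collidePairWith i j (ω : V3) z i).2) ω) *
        (hardSphereDomain geo (N + 1) (hsDiameter σ N)).indicator ((collidePair geo i j ⁻¹' B).indicator 1)
          (placeAt σ N i j (collidePairWith i j (ω : V3) z, (ω : V3))) =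
      ENNReal.ofReal (hardSphereKernel ((z i).2, (z j).2) ω) *
        (hardSphereDomain geo (N + 1) (hsDiameter σ N)).indicator (B.indicator 1) (placeAt σ N i j (z, (ω : V3)))
    rw [hk, hpl]
    congr 1
    by_cases hDm : placeAt σ N i j (z, (ω : V3)) ∈ hardSphereDomain geo (N + 1) (hsDiameter σ N)
    · have hDm' : collidePair geo i j (placeAt σ N i j (z, (ω : V3))) ∈ hardSphereDomain geo (N + 1) (hsDiameter σ N) :=
        (collidePair_mem_hardSphereDomain_iff _).2 hDm
      rw [indicator_of_mem hDm', indicator_of_mem hDm]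
      by_cases hBm : placeAt σ N i j (z, (ω : V3)) ∈ B
      · have hBm' : collidePair geo i j (placeAt σ N i j (z, (ω : V3))) ∈ collidePair geo i j ⁻¹' B := by
          rw [mem_preimage, collidePair_collidePair hij]; exact hBm
        rw [indicator_of_mem hBm', indicator_of_mem hBm]
        rfl
      · have hBm' : collidePair geo i j (placeAt σ N i j (z, (ω : V3))) ∉ collidePair geo i j ⁻¹' B := by
          rw [mem_preimage, collidePair_collidePair hij]; exact hBm
        rw [indicator_of_notMem hBm', indicator_of_notMem hBm]
    · have hDm' : collidePair geo i j (placeAt σ N i j (z, (ω : V3))) ∉ hardSphereDomain geo (N + 1) (hsDiameter σ N) :=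
        fun h => hDm ((collidePair_mem_hardSphereDomain_iff _).1 h)
      rw [indicator_of_notMem hDm', indicator_of_notMem hDm]
  rw [exitFlux, entryFlux, ← lintegral_indicator_one (hB.preimage hcP), ← lintegral_indicator_one hB,
    lintegral_pairFlux_sphere i j i j μ (measurable_one.indicator (hB.preimage hcP)),
    lintegral_pairFlux_sphere i j j i μ (measurable_one.indicator hB)]
  refine congrArg (fun t => ENNReal.ofReal (hsDiameter σ N ^ 2) * t) ?_
  change ∫⁻ z, ∫⁻ ω, Gx (z, ω) ∂sphereMeasure ∂μ = ∫⁻ z, ∫⁻ ω, Ge (z, ω) ∂sphereMeasure ∂μ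
  rw [lintegral_lintegral_swap (f := fun z ω => Gx (z, ω)) hGxm.aemeasurable,
    lintegral_lintegral_swap (f := fun z ω => Ge (z, ω)) hGem.aemeasurable]
  refine lintegral_congr fun ω => ?_
  have hGxω : Measurable fun z : Cfg N => Gx (z, ω) := hGxm.comp (measurable_id.prodMk measurable_const)
  rw [← (hμ (ω : V3)).lintegral_comp hGxω]
  exact lintegral_congr fun z => key ω z

/-- The same as a push-forward identity: `collidePair_* exitFlux = entryFlux`. [cite: CometsEtAl2008, Thm 2.4] -/
theorem map_collidePair_exitFlux {i j : Fin (N + 1)} (hij : i ≠ j) (hε : 0 < hsDiameter σ N)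
    (hε2 : hsDiameter σ N < 1 / 2) (μ : Measure (Cfg N)) [SFinite μ]
    (hμ : ∀ ω : V3, MeasurePreserving (collidePairWith i j ω : Cfg N → Cfg N) μ μ) :
    (exitFlux σ N i j μ).map (collidePair geo i j) = entryFlux σ N i j μ := by
  refine Measure.ext fun B hB => ?_
  rw [Measure.map_apply (Torus.isMeasurable_geometry.measurable_collidePair i j) hB]
  exact exitFlux_preimage_collidePair hij hε hε2 μ hμ hB

end Literature.MathematicalPhysics.KineticTheory.KickMatchedHardSphereGas

end
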